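import Mathlib
import Summits.NavierStokesRegularity.NavierStokesRegularity.Theses.CompletionRelayChain
import Literature.Analysis.FluidPDE.Tao2016AveragedNS.RestartedCascadeFlows
import Summits.NavierStokesRegularity.NavierStokesRegularity.Theorems.CompletionRelayChainDefs
import Summits.NavierStokesRegularity.NavierStokesRegularity.Theorems.CompletionRelayChainRelayFrontStepIdle
import Summits.NavierStokesRegularity.NavierStokesRegularity.Theorems.CompletionRelayChainRelayFrontStepStubTail
import Summits.NavierStokesRegularity.NavierStokesRegularity.Theorems.CompletionRelayChainRelayFrontStepBlockApriori
import Summits.NavierStokesRegularity.NavierStokesRegularity.Theorems.CompletionRelayChainRelayFrontStepStubSlack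
import HarnessLib

/-!
# Route `CompletionRelayChain` — crux `RelayFrontStep` (stmt-NavierStokesRegularity-24850), LINE `window_v2`:
  the PROVED PIECES of the lead's skeleton that do not depend on the open stub `stub_ignition`

Moved verbatim out of the registered skeleton `Cruxes/RelayFrontStep/Lines/window_v2.lean` (v8) so that the closing
file stays under the size limit: the wake-shell step `stub_wakeShell` (wrapper of the landed `wake_shell`), the idle
mode `stub_idle` with its envelope lemmas (`idleE_pos`, `idleE_succ_le`, `idleE_le_relayEnv₂`), the window property of
the tuned datum `relayDatum_window₃`, and three numeric lemmas used by the robust step (`rpow_neg_half_le`,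
`shell_three_reenters`, `relayEnv₂_ge_of_le_neg_one`).

MODEL-lattice bookkeeping (rung TL-M3-R64); nothing here is a statement about the Navier–Stokes equations.
-/

noncomputable section
set_option linter.dupNamespace false

open Set Literature.Analysis.FluidPDE.TaoCascade

namespace Summit.NavierStokesRegularity.NavierStokesRegularity.Cruxes.RelayFrontStep.Window2

/-- `wakeS k = (1/8)·2^{−k}`. -/
theorem wakeS_eq (k : ℤ) : wakeS k = (1 / 8) * (2 : ℝ) ^ (-(k : ℝ)) := by
  unfold wakeS; ring

/-- **STUB `stub_wakeShell` — PROVED** (wrapper of the landed `wake_shell`): along any `(η,η)`-pseudo-flow of a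
table with the relay rows, started with the shell-energy wake clauses of `W₃` and with old shell `−3` under
the epoch envelope on the hop window `[0, τ₁]` (`τ₁ ≤ 8`), the energies of the old shells `k ≤ −4` stay
under `relayEnv₂` and the shell-energy wake clauses re-enter one shell deeper (`k ≤ −5`) for any `a ≥ 17/20`. -/
theorem stub_wakeShell :
  ∀ α : Fin 4 → Fin 4 → Fin 4 → ℤ × ℤ × ℤ → ℝ, InTableClass 64 α → RelayRows α →
    ∀ (τ : ℝ) (S₀ F₀ B₀ : Fin 4 → ℤ → ℝ) (S F : Fin 4 → ℤ → ℝ → ℝ), 0 < τ →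
      PseudoFlowOn τ 1 α (1 / 10 ^ 8) (1 / 10 ^ 8) S₀ F₀ B₀ S F →
      (∀ k : ℤ, k ≤ -1 → ∑ i, F₀ i k ≤ wakeS k) →
      ∀ τ₁ ∈ Icc (0 : ℝ) τ, τ₁ ≤ 8 →
        (∀ s ∈ Icc (0 : ℝ) τ₁, ∀ i : Fin 4, i ≠ 3 → F i (-3) s ≤ relayEnv₂ (-3)) →
        (∀ s ∈ Icc (0 : ℝ) τ₁, ∀ (i : Fin 4) (k : ℤ), k ≤ -4 → i ≠ 3 → F i k s ≤ relayEnv₂ k) ∧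
        ∀ a : ℝ, 17 / 20 ≤ a →
          ∀ k : ℤ, k ≤ -5 → (∑ i, F i (1 + k) τ₁) / a ^ 2 ≤ wakeS k := by
  intro α _hE hrows τ S₀ F₀ B₀ S F hτ hflow hwake τ₁ hτ₁ hτ₁8 h3
  simp only [wakeS_eq] at hwake ⊢
  exact wake_shell hflow hτ hrows hwake hτ₁ hτ₁8 h3

/-! ### The idle mode (PROVED): zero row ⇒ energies non-increasing ⇒ clauses re-enter, envelope holds -/

/-- `idleE` is positive. -/
theorem idleE_pos (k : ℤ) : 0 < idleE k := by
  unfold idleE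
  split_ifs <;> positivity

/-- `idleE` at least halves from one shell to the next. -/
theorem idleE_succ_le (k : ℤ) : idleE (1 + k) ≤ idleE k / 2 := by
  unfold idleE
  have h2 : (2 : ℝ) ^ (-((1 + k : ℤ) : ℝ)) = (2 : ℝ) ^ (-(k : ℝ)) / 2 := by
    push_cast
    rw [show -(1 + (k : ℝ)) = -(k : ℝ) - 1 by ring, Real.rpow_sub (by norm_num), Real.rpow_one]
  have h64 : (64 : ℝ) ^ (-(4 : ℝ) * (((1 + k : ℤ) : ℝ) - 1)) =
      (64 : ℝ) ^ (-(4 : ℝ) * ((k : ℝ) - 1)) / 16777216 := by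
    push_cast
    rw [show -(4 : ℝ) * (1 + (k : ℝ) - 1) = -(4 : ℝ) * ((k : ℝ) - 1) - (4 : ℕ) by push_cast; ring,
      Real.rpow_sub (by norm_num), Real.rpow_natCast]
    norm_num
  have hA : 0 < (2 : ℝ) ^ (-(k : ℝ)) := Real.rpow_pos_of_pos (by norm_num) _
  have hB : 0 < (64 : ℝ) ^ (-(4 : ℝ) * ((k : ℝ) - 1)) := Real.rpow_pos_of_pos (by norm_num) _
  split_ifs with hk1 hk2 hk2
  · -- k ≤ 0: equality
    rw [h2]; ring_nf; rfl
  · exfalso; omega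
  · -- k = 1
    have hk : k = 1 := by omega
    subst hk
    rw [h64]
    have e1 : (64 : ℝ) ^ (-(4 : ℝ) * (((1 : ℤ) : ℝ) - 1)) = 1 := by norm_num
    have e2 : (2 : ℝ) ^ (-((1 : ℤ) : ℝ)) = 1 / 2 := by
      push_cast
      rw [Real.rpow_neg_one]; norm_num
    rw [e1, e2]; norm_num
  · -- k ≥ 2
    rw [h64]
    nlinarith

/-- `idleE` lies under the epoch envelope `relayEnv₂`. -/
theorem idleE_le_relayEnv₂ (k : ℤ) : idleE k ≤ relayEnv₂ k := by
  unfold idleE relayEnv₂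
  have hA : 0 < (2 : ℝ) ^ (-(k : ℝ)) := Real.rpow_pos_of_pos (by norm_num) _
  have hB : 0 < (64 : ℝ) ^ (-(4 : ℝ) * ((k : ℝ) - 1)) := Real.rpow_pos_of_pos (by norm_num) _
  split_ifs with hk1 hk2 hk2
  · nlinarith
  · exfalso; omega
  · -- k = 2
    have hk : k = 2 := by omega
    subst hk
    have e1 : (64 : ℝ) ^ (-(4 : ℝ) * (((2 : ℤ) : ℝ) - 1)) = 1 / 16777216 := by
      push_cast
      rw [show -(4 : ℝ) * (2 - 1) = -((4 : ℕ) : ℝ) by norm_num, Real.rpow_neg (by norm_num),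
        Real.rpow_natCast]
      norm_num
    have e2 : (2 : ℝ) ^ (-((2 : ℤ) : ℝ)) = 1 / 4 := by
      push_cast
      rw [show -(2 : ℝ) = -((2 : ℕ) : ℝ) by norm_num, Real.rpow_neg (by norm_num), Real.rpow_natCast]
      norm_num
    rw [e1, e2]; norm_num
  · nlinarith

/-- **STUB `stub_idle` — PROVED.** Along any pseudo-flow of a table with the relay rows the idle mode's
energies are non-increasing (its row is zero and (4.9) has no defect term); hence the idle clauses of
`W₂` propagate under `relayEnv₂` on the whole horizon and re-enter after rescaling by any `a` with
`a² ≥ 1/2` (here `a ≥ 17/20`). -/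
theorem stub_idle :
  ∀ α : Fin 4 → Fin 4 → Fin 4 → ℤ × ℤ × ℤ → ℝ, InTableClass 64 α → RelayRows α →
    ∀ (τ : ℝ) (S₀ F₀ B₀ : Fin 4 → ℤ → ℝ) (S F : Fin 4 → ℤ → ℝ → ℝ), 0 < τ →
      PseudoFlowOn τ 1 α (1 / 10 ^ 8) (1 / 10 ^ 8) S₀ F₀ B₀ S F →
      (∀ k : ℤ, F₀ 3 k ≤ idleE k) →
        (∀ s ∈ Icc (0 : ℝ) τ, ∀ k : ℤ, F 3 k s ≤ relayEnv₂ k) ∧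
        ∀ τ₁ ∈ Icc (0 : ℝ) τ, ∀ a : ℝ, 17 / 20 ≤ a → ∀ k : ℤ, F 3 (1 + k) τ₁ / a ^ 2 ≤ idleE k := by
  intro α _hE hrows τ S₀ F₀ B₀ S F hτ hflow hidle
  -- the idle energies never exceed their start values (zero row; tree `RelayFrontStep.idle_energy_le_init`)
  have hmono : ∀ s ∈ Icc (0 : ℝ) τ, ∀ k : ℤ, F 3 k s ≤ F₀ 3 k := fun s hs k =>
    Summit.NavierStokesRegularity.NavierStokesRegularity.Theorems.RelayFrontStep.idle_energy_le_init
      hflow hτ 3 hrows.2.2.2 k hs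
  refine ⟨fun s hs k => ((hmono s hs k).trans (hidle k)).trans (idleE_le_relayEnv₂ k), ?_⟩
  intro τ₁ hτ₁ a ha k
  have ha2 : 1 / 2 ≤ a ^ 2 := by nlinarith
  have hpos : 0 < a ^ 2 := by positivity
  rw [div_le_iff₀ hpos]
  have h1 := (hmono τ₁ hτ₁ (1 + k)).trans (hidle (1 + k))
  have h2 := idleE_succ_le k
  have h3 := idleE_pos k
  nlinarith

/-! ### The tuned datum is a `W₃`-state -/

/-- The tuned datum is a window state (plain numerals: zeros off the front shell satisfy every upper
clause and every floor; energies off the front shell are zero). -/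
theorem relayDatum_window₃ : RelayWindow₃ (datumState 0 relayX0) (datumEnergy 0 relayX0) := by
  have h0 : |relayX0 0| = 1 := by simp [relayX0]
  unfold RelayWindow₃
  simp only [datumState, datumEnergy, h0, div_one, one_pow]
  refine ⟨?_, ?_, ?_, ?_, ?_, ?_, ?_, ?_, ?_, ?_, ?_, ?_, ?_⟩
  · norm_num [relayX0]
  · norm_num [relayX0]
  · have : relayX0 2 = 38 / 100000 := by simp [relayX0]
    rw [this]; norm_num
  · have : relayX0 2 = 38 / 100000 := by simp [relayX0]
    rw [this]; norm_num
  · norm_num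
  · norm_num
  · norm_num
  · norm_num
  · norm_num
  · norm_num
  · intro k hk i _
    have hk0 : k ≠ 0 := by omega
    simp only [hk0, if_false]
    unfold aheadE; positivity
  · intro k hk
    have hk0 : k ≠ 0 := by omega
    simp only [hk0, if_false, Finset.sum_const_zero]
    unfold wakeS; positivity
  · intro k
    by_cases hk0 : k = 0
    · subst hk0
      have : relayX0 3 = 0 := by simp [relayX0]
      simp only [if_true, this]
      norm_num
      exact (idleE_pos 0).le
    · simp only [hk0, if_false]
      exact (idleE_pos k).le

/-! ### Composition -/

/-- `2^{−1/2} ≤ 17/20`. -/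
theorem rpow_neg_half_le : (1 + 1 : ℝ) ^ (-(1 / 2 : ℝ)) ≤ 17 / 20 := by
  have h1 : (1 + 1 : ℝ) ^ (-(1 / 2 : ℝ)) = (Real.sqrt 2)⁻¹ := by
    rw [Real.rpow_neg (by norm_num), Real.sqrt_eq_rpow]
    norm_num
  rw [h1]
  have h2 : (20 / 17 : ℝ) ≤ Real.sqrt 2 := by
    have h3 : ((20 / 17 : ℝ)) ^ 2 ≤ 2 := by norm_num
    calc (20 / 17 : ℝ) = Real.sqrt ((20 / 17 : ℝ) ^ 2) := by rw [Real.sqrt_sq (by norm_num)]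
      _ ≤ Real.sqrt 2 := Real.sqrt_le_sqrt h3
  calc (Real.sqrt 2)⁻¹ ≤ (20 / 17 : ℝ)⁻¹ := inv_anti₀ (by norm_num) h2
    _ = 17 / 20 := by norm_num

/-- `6e-20 ≤ a²·aheadE 2` for `a ≥ 17/20`: the first far-ahead clause after the hop from the shell-3 bound. -/
theorem shell_three_reenters {a : ℝ} (ha : 17 / 20 ≤ a) : (6 / 10 ^ 20 : ℝ) ≤ aheadE 2 * a ^ 2 := by
  have ha2 : 289 / 400 ≤ a ^ 2 := by nlinarith
  have h : aheadE 2 = (1 / 2) * (5 / 10 ^ 10) ^ 2 := by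
    unfold aheadE
    have : (64 : ℝ) ^ (-(2 : ℝ) * (((2 : ℤ) : ℝ) - 2)) = 1 := by norm_num
    rw [this]; ring
  rw [h]; nlinarith

/-- `relayEnv₂ k ≥ 5/2` for `k ≤ −1` (indeed `≥ 4`). -/
theorem relayEnv₂_ge_of_le_neg_one {k : ℤ} (hk : k ≤ -1) : (5 / 2 : ℝ) ≤ relayEnv₂ k := by
  unfold relayEnv₂
  rw [if_pos (by omega)]
  have h : ((1 : ℕ) : ℝ) ≤ -(k : ℝ) := by
    have : (k : ℝ) ≤ -1 := by exact_mod_cast hk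
    push_cast; linarith
  have h2 : (2 : ℝ) ≤ (2 : ℝ) ^ (-(k : ℝ)) := by
    calc (2 : ℝ) = (2 : ℝ) ^ ((1 : ℕ) : ℝ) := by rw [Real.rpow_natCast]; norm_num
      _ ≤ (2 : ℝ) ^ (-(k : ℝ)) := Real.rpow_le_rpow_of_exponent_le (by norm_num) h
  linarith

end Summit.NavierStokesRegularity.NavierStokesRegularity.Cruxes.RelayFrontStep.Window2

end
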